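import Summits.BirchSwinnertonDyer.Rank1Residual.X11b.Three.JetchevKummerLink
import HarnessLib

/-!
# X11b at `p = 3` (team N8/O2), JET3-KUMMER (c′): Jetchev's Prop. 4.1 at a bad place in the
# RESTRICTED-GLOBAL currency (the currency of the Selmer group and of the Jetchev-road consumer)

HONEST FRAMING (cell `b2b-bsdres`, run/shared/lean/b2b/bsd-rank1-residual/, verbatim in every
file): the goal of the cell is to DELETE the COMBINATION-SHAPED residual classes of the
Birch–Swinnerton-Dyer formula for ALL analytic-rank `≤ 1` elliptic curves over `ℚ` — "full BSD
formula for every rank `≤ 1` curve in class `C`" assembled STRICTLY from published theorems — so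
that the rank-`≤ 1` remainder becomes exactly the CONSTRUCTION-SHAPED classes, which are TYPED
(missing-input `Prop`s), NOT attempted. This is not "finishing BSD". Team N8/O2 = `x11b3`, seat
`b2b-bsdres-x11b3-p1`; continuation of `Three/JetchevKummerLink.lean` (p253058) closing the
currency gap recorded in its OWNERS close row. THEOREMS ONLY: no definition, no named fact, no
`sorry`; nothing is booked; the flag `JET@p|N` is NOT discharged here.

## What

`Three/JetchevKummerLink.lean` §3 (`localKummerMap_mem_connectedKummerCondition_of_cocycle`) is
stated for a curve DEFINED over the local field `F` — the currency of `Three/JetchevKummerAtP.lean`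
(p251610) and `Three/GoodReductionSubgroupUnramified.lean` / `…GaloisH1.lean` (p252555 / p252933).
Its consumers live in the tree's RESTRICTED-GLOBAL currency: a curve `W` over a global field `K₀`
(`ℚ`, or the Heegner field), a `K₀`-field `F = K_v`, the local Kummer map `W.localKummerMap F` on
`(W⁄F)(F)`, the local kernels `selmerLocalKer W F n = res_F⁻¹ 𝓛_F`
(`Three/KolyvaginClassBadPlace.lean` §3, p253373) and the typed `connectedKummerCondition W F R₀`
of `JetchevKummerLink` §1/§2/§4. The bridge costs nothing: Mathlib's `(W⁄F)⁄F = W⁄F` holds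
DEFINITIONALLY, so the `F`-points of the local curve `W⁄F` ARE `(W⁄F)(F)`; apply the local
decomposition (p251610) and descent (p252555) to `W⁄F`, read the conclusion on points
(`t = t₀ + p^m t₁`, `t₀ ∈ E₀(F)`), and feed `JetchevKummerLink` §1.

* `localKummerMap_mem_connectedKummerCondition_of_cocycle_baseChange` — **Prop. 4.1 at a bad
  place `v` (any `v ∣ N`, `v ∣ p` included) for a GLOBAL curve**, modulo the named inputs hstab,
  (α), (b), and the explicit cocycle rooted at `t ∈ (W⁄F)(F)` (input (a), supplied in this
  currency by `GrossBadPlace.exists_localKummerMap_eq_res_of_mem_selmerLocalKer`):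
  `W.localKummerMap F hn t ∈ connectedKummerCondition W F R₀ hn`.

References (locators only; no cited FACT): [cite: Jetchev2008, Prop. 4.1 (pp. 819–821)]
[cite: GrossLMS1991, Prop. 6.2 (1), pp. 244–245]; cell files p248445, p251610, p252555, p252933,
p253058, p253373.
-/

noncomputable section

open scoped Classical

namespace Summit.BirchSwinnertonDyer.Rank1Residual.X11b.Three.JetchevKummer

open WeierstrassCurve Literature.NumberTheory.EllipticCurves
  Literature.NumberTheory.GaloisRepresentations Field

universe u

/-! ### Prop. 4.1 at a bad place, restricted-global currency -/

section Global

variable {K₀ : Type u} [Field K₀] [CharZero K₀] (W : WeierstrassCurve K₀) [W.IsElliptic]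
  (F : Type u) [Field F] [Algebra K₀ F] [CharZero F]
  (L : Type u) [Field L] [Algebra F L]
  (R₀ : Type*) [CommRing R₀] [IsDomain R₀] [IsDiscreteValuationRing R₀] [Algebra R₀ F]
  [IsFractionRing R₀ F]
  (R : Type*) [CommRing R] [IsDomain R] [IsDiscreteValuationRing R] [Algebra R L]
  [IsFractionRing R L]
  [Algebra R₀ R] [Algebra R₀ L] [IsScalarTower R₀ R L] [IsScalarTower R₀ F L]

/-- **Jetchev 2008, Prop. 4.1 at a bad place `v`, restricted-global currency, modulo the named
inputs.** `W` over a global field `K₀` (`ℚ`, or the Heegner field `K`), `F = K_v` a `K₀`-field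
with valuation ring `R₀`, `L = K[c]_w ⊇ F` Galois with valuation ring `R`, `R₀ → R` local, the
equation of `W⁄F` minimal over `R₀` and that of `(W⁄F)⁄L` over `R` (at `v ∣ p ∥ N`: p4's
`isMinimal_baseChange_of_hasMultiplicativeReduction`); the Galois group `Gal(L/F) = L ≃ₐ[F] L`
acts on `((W⁄F)⁄L)(L)` and `ι = Affine.Point.baseChange F L : (W⁄F)(F) → ((W⁄F)⁄L)(L)`. Inputs
exactly as in §3 / `JetchevKummerAtP` (hstab, (α) `hα`, (b) `hP`/`hR` with `n′` prime to `p^m`,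
the explicit cocycle `hU`/`hpU` rooted at `t ∈ (W⁄F)(F)` = input (a), supplied in this currency
by `GrossBadPlace.exists_localKummerMap_eq_res_of_mem_selmerLocalKer`). Conclusion in the currency
of the Selmer group: **`W.localKummerMap F hn t ∈ connectedKummerCondition W F R₀ hn`**, i.e.
`loc_v(κ) ∈ H¹_{Kum⁰}(K_v, E[p^m])` for any global class `κ` with `res_v κ = δ_v(t)`.
[cite: Jetchev2008, Prop. 4.1 (pp. 819–821)] [cite: GrossLMS1991, Prop. 6.2 (1), pp. 244–245] -/
theorem localKummerMap_mem_connectedKummerCondition_of_cocycle_baseChange [IsGalois F L]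
    [IsLocalHom (algebraMap R₀ R)] [(W.baseChange F).IsMinimal R₀]
    [((W.baseChange F).baseChange L).IsMinimal R]
    (hstab : ∀ (σ : L ≃ₐ[F] L) (Q : ((W.baseChange F).baseChange L).toAffine.Point),
      Q ∈ ((W.baseChange F).baseChange L).goodReductionSubgroup R →
        σ • Q ∈ ((W.baseChange F).baseChange L).goodReductionSubgroup R)
    (hα : ∀ Q : ((W.baseChange F).baseChange L).toAffine.Point,
      (∀ σ : L ≃ₐ[F] L, σ • Q - Q ∈ ((W.baseChange F).baseChange L).goodReductionSubgroup R) →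
        ∃ Q' : ((W.baseChange F).baseChange L).toAffine.Point, (∀ σ : L ≃ₐ[F] L, σ • Q' = Q') ∧
          Q - Q' ∈ ((W.baseChange F).baseChange L).goodReductionSubgroup R)
    {p m n' : ℕ} (hcop : Nat.Coprime n' (p ^ m)) (hn : ((p ^ m : ℕ) : ℤ) ≠ 0)
    {t : (W.baseChange F).toAffine.Point} {U P : ((W.baseChange F).baseChange L).toAffine.Point}
    {Rσ : (L ≃ₐ[F] L) → ((W.baseChange F).baseChange L).toAffine.Point}
    (hP : (n' : ℤ) • P ∈ ((W.baseChange F).baseChange L).goodReductionSubgroup R)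
    (hR : ∀ σ : L ≃ₐ[F] L, (n' : ℤ) • Rσ σ ∈ ((W.baseChange F).baseChange L).goodReductionSubgroup R)
    (hU : ∀ σ : L ≃ₐ[F] L, σ • U - U = Rσ σ)
    (hpU : ((p ^ m : ℕ) : ℤ) • U =
      P - Affine.Point.baseChange (W' := (W.baseChange F).toAffine) F L t) :
    W.localKummerMap F hn t ∈ connectedKummerCondition W F R₀ hn := by
  -- `(W⁄F)⁄F = W⁄F` definitionally: the instance and the points transfer silently
  haveI : ((W.baseChange F).baseChange F).IsMinimal R₀ := ‹(W.baseChange F).IsMinimal R₀›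
  obtain ⟨T₀, T₁, h0, h1, hT₀, hdec⟩ :=
    exists_mem_goodReductionSubgroup_add_pow_smul (W.baseChange F) L R hstab hα hcop
      (fun σ ↦ smul_baseChange (W.baseChange F) L σ t) hP hR hU hpU
  obtain ⟨t₀, ht₀, rfl⟩ :=
    (mem_goodReductionSubgroup_iff_exists_of_forall_smul_eq (W.baseChange F) L R₀ R h0).mp hT₀
  obtain ⟨t₁, rfl⟩ := exists_baseChange_eq_of_forall_smul_eq (W.baseChange F) L T₁ h1
  have ht : t = t₀ + ((p ^ m : ℕ) : ℤ) • t₁ := by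
    apply Affine.Point.map_injective (W' := ((W.baseChange F).baseChange F).toAffine)
      (f := Algebra.ofId F L)
    change Affine.Point.baseChange (W' := (W.baseChange F).toAffine) F L t =
      Affine.Point.baseChange (W' := (W.baseChange F).toAffine) F L (t₀ + ((p ^ m : ℕ) : ℤ) • t₁)
    rw [map_add, map_zsmul, ← hdec]
  exact localKummerMap_mem_connectedKummerCondition_of_eq_add_zsmul W F R₀ hn ht₀ ht

end Global

end Summit.BirchSwinnertonDyer.Rank1Residual.X11b.Three.JetchevKummer

end
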